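import Literature.Barriers.AtomisticToContinuum.MazurBoundBallisticOpenChain
import Summits.AtomisticToContinuum.FouriersLaw.Theorems.JunctionLocalitySuperadditiveResistancePlainAdjoint

/-!
# `CorrectorTheory` (stmt-AtomisticToContinuum-14071), part 6a: weighted site energies and the local energy balance

Helper file for support item `stmt-AtomisticToContinuum-14071`
(`OddSectorIrreversibility.CorrectorTheory`, conjunct A (5), the bond sum rule).

For an oscillator chain `P` with differentiable potentials and site weights `c : Fin N → ℝ`, the
WEIGHTED ENERGY `X_c = ∑_k c_k (p_k²/2 + U(q_k)) + ∑_{l=k+1} ((c_k+c_l)/2) V(q_l - q_k)` (bond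
energies split evenly between their two sites; `c_k = k` is the energy moment of
`MazurBoundBallisticOpenChain.lean`, `c_k = [k = m]` the site energy `h_m`) satisfies

* `partialP_weightedEnergy` — `∂_{p_i} X_c = c_i p_i`; `partialQ_weightedEnergy` — the closed
  form of `∂_{q_i} X_c`;
* `poisson_hamiltonian_weightedEnergy` — **the local energy balance, summed with weights**:
  `{H, X_c} = ∑_{bonds (k,k+1)} (c_{k+1} - c_k) j_k`;
* `liouvilleOp_siteEnergy` — for the site energy `h_m` (`c = [· = m]`) and `m = i + 1`:
  `X_H h_m = j_i - j_m` (energy enters site `m` through bond `(i, m)` and leaves through `(m, m+1)`);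
  `partialP_siteEnergy`, `siteEnergy_neg_momentum`, `siteEnergy_nonneg`, `siteEnergy_le_hamiltonian`.

The weighted energy is passed as a hypothesis `hX : X = fun x => …` (no new definition).
References: Bonetto–Lebowitz–Rey-Bellet 2000 §5.2 (local energy conservation defines the bond
currents); folklore. Nothing here closes the item.
-/

noncomputable section

open MeasureTheory Filter Topology
open Literature.MathematicalPhysics.KineticTheory.HeatConduction
open Literature.MathematicalPhysics.KineticTheory.HeatConduction.OscillatorChain
open Summit.AtomisticToContinuum.FouriersLaw.Theorems.SuperadditiveResistance.DeviceLiouville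

namespace Summit.AtomisticToContinuum.FouriersLaw.Theorems.OddSectorIrreversibility.Corrector

variable (P : OscillatorChain) {N : ℕ}

section Weighted

variable (c : Fin N → ℝ) (X : PhaseSpace N → ℝ)
  (hX : X = fun x => (∑ k : Fin N, c k * (x.2 k ^ 2 / 2 + P.U (x.1 k))) +
    ∑ k : Fin N, ∑ l : Fin N,
      if l.val = k.val + 1 then (c k + c l) / 2 * P.V (x.1 l - x.1 k) else 0)
include hX

/-- `∂_{p_i} X_c = c_i p_i`. [folklore] -/
theorem partialP_weightedEnergy (i : Fin N) (x : PhaseSpace N) :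
    partialP i X x = c i * x.2 i := by
  subst hX
  unfold partialP
  have h1 : HasDerivAt (fun t : ℝ => ∑ k : Fin N,
      c k * ((Function.update x.2 i t k) ^ 2 / 2 + P.U (x.1 k)))
      (∑ k : Fin N, if k = i then c i * x.2 i else 0) (x.2 i) := by
    apply HasDerivAt.fun_sum
    intro k _
    by_cases hk : k = i
    · subst hk
      simp only [Function.update_self, if_true]
      have h' : HasDerivAt (fun t : ℝ => t ^ 2 / 2 + P.U (x.1 k)) (x.2 k) (x.2 k) := by
        have h := ((hasDerivAt_pow 2 (x.2 k)).div_const 2).add_const (P.U (x.1 k))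
        have he : ((2 : ℕ) : ℝ) * x.2 k ^ (2 - 1) / 2 = x.2 k := by norm_num
        rwa [he] at h
      exact h'.const_mul _
    · simp only [Function.update_of_ne hk, hk, if_false]
      exact hasDerivAt_const _ _
  have h2 : HasDerivAt (fun _ : ℝ => ∑ k : Fin N, ∑ l : Fin N,
      if l.val = k.val + 1 then (c k + c l) / 2 * P.V (x.1 l - x.1 k) else 0) 0 (x.2 i) :=
    hasDerivAt_const _ _
  have h := h1.add h2
  simp only [Finset.sum_ite_eq', Finset.mem_univ, if_true, add_zero] at h
  exact h.deriv

/-- Closed form of `∂_{q_i} X_c`: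
`c_i U'(q_i) + ∑_{l = k+1} ((c_k+c_l)/2) V'(q_l - q_k) ([l = i] - [k = i])`. [folklore] -/
theorem partialQ_weightedEnergy (hU : Differentiable ℝ P.U) (hV : Differentiable ℝ P.V)
    (i : Fin N) (x : PhaseSpace N) :
    partialQ i X x = c i * deriv P.U (x.1 i) + ∑ k : Fin N, ∑ l : Fin N,
      if l.val = k.val + 1 then
        (c k + c l) / 2 * deriv P.V (x.1 l - x.1 k) *
          ((if l = i then 1 else 0) - (if k = i then 1 else 0)) else 0 := by
  subst hX
  unfold partialQ
  have h1 : HasDerivAt (fun t : ℝ => ∑ k : Fin N,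
      c k * (x.2 k ^ 2 / 2 + P.U (Function.update x.1 i t k)))
      (∑ k : Fin N, if k = i then c i * deriv P.U (x.1 i) else 0) (x.1 i) := by
    apply HasDerivAt.fun_sum
    intro k _
    by_cases hk : k = i
    · subst hk
      simp only [Function.update_self, if_true]
      exact (((hU _).hasDerivAt).const_add _).const_mul _
    · simp only [Function.update_of_ne hk, hk, if_false]
      exact hasDerivAt_const _ _
  have h2 : HasDerivAt (fun t : ℝ => ∑ k : Fin N, ∑ l : Fin N,
      if l.val = k.val + 1 then (c k + c l) / 2 * P.V (Function.update x.1 i t l -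
        Function.update x.1 i t k) else 0)
      (∑ k : Fin N, ∑ l : Fin N, if l.val = k.val + 1 then
        (c k + c l) / 2 * deriv P.V (x.1 l - x.1 k) *
          ((if l = i then 1 else 0) - (if k = i then 1 else 0)) else 0) (x.1 i) := by
    refine HasDerivAt.fun_sum fun k _ => HasDerivAt.fun_sum fun l _ => ?_
    by_cases hlk : l.val = k.val + 1
    · simp only [hlk, if_true]
      have ha : HasDerivAt (fun t => Function.update x.1 i t l - Function.update x.1 i t k)
          ((if l = i then 1 else 0) - (if k = i then 1 else 0)) (x.1 i) := by
        refine HasDerivAt.sub ?_ ?_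
        · by_cases hl : l = i
          · subst hl; simp only [Function.update_self, if_true]; exact hasDerivAt_id _
          · simp only [Function.update_of_ne hl, hl, if_false]; exact hasDerivAt_const _ _
        · by_cases hk : k = i
          · subst hk; simp only [Function.update_self, if_true]; exact hasDerivAt_id _
          · simp only [Function.update_of_ne hk, hk, if_false]; exact hasDerivAt_const _ _
      have hcomp := ((hV _).hasDerivAt).comp (x.1 i) ha
      have heval : Function.update x.1 i (x.1 i) l - Function.update x.1 i (x.1 i) k =
          x.1 l - x.1 k := by simp
      rw [heval] at hcomp
      have := hcomp.const_mul ((c k + c l) / 2)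
      rw [← mul_assoc] at this
      exact this
    · simp only [hlk, if_false]
      exact hasDerivAt_const _ _
  have h := h1.add h2
  simp only [Finset.sum_ite_eq', Finset.mem_univ, if_true] at h
  exact h.deriv

/-- **The weighted local energy balance**: `{H, X_c} = ∑_{bonds (k, l=k+1)} (c_l - c_k) j_{k}`,
`j_k = -½(p_k + p_l) V'(q_l - q_k)` — each bond transfers energy from site `k` to site `l`
at rate `j_k`. [folklore] -/
theorem poisson_hamiltonian_weightedEnergy (hU : Differentiable ℝ P.U) (hV : Differentiable ℝ P.V)
    (x : PhaseSpace N) :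
    poisson (P.hamiltonian N) X x = ∑ k : Fin N, ∑ l : Fin N, if l.val = k.val + 1 then
      (c l - c k) * (-((x.2 k + x.2 l) / 2 * deriv P.V (x.1 l - x.1 k))) else 0 := by
  unfold poisson
  simp only [P.partialP_hamiltonian, P.partialQ_hamiltonian_eq_dPotential hU hV,
    partialP_weightedEnergy P c X hX, partialQ_weightedEnergy P c X hX hU hV]
  have key : ∀ i : Fin N,
      x.2 i * (c i * deriv P.U (x.1 i) + ∑ k : Fin N, ∑ l : Fin N, (if l.val = k.val + 1 then
        (c k + c l) / 2 * deriv P.V (x.1 l - x.1 k) *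
          ((if l = i then 1 else 0) - (if k = i then 1 else 0)) else 0)) -
        P.dPotential N i x.1 * (c i * x.2 i) =
        ∑ k : Fin N, ∑ l : Fin N, if l.val = k.val + 1 then
          x.2 i * deriv P.V (x.1 l - x.1 k) * (((c k + c l) / 2 - c i) *
            ((if l = i then 1 else 0) - (if k = i then 1 else 0))) else 0 := by
    intro i
    unfold OscillatorChain.dPotential
    set A := ∑ k : Fin N, ∑ l : Fin N, (if l.val = k.val + 1 then
      (c k + c l) / 2 * deriv P.V (x.1 l - x.1 k) *
        ((if l = i then 1 else 0) - (if k = i then 1 else 0)) else 0) with hA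
    set B := ∑ k : Fin N, ∑ l : Fin N, (if l.val = k.val + 1 then
      deriv P.V (x.1 l - x.1 k) * ((if l = i then 1 else 0) - (if k = i then 1 else 0))
        else 0) with hB
    have h1 : x.2 i * (c i * deriv P.U (x.1 i) + A) -
        (deriv P.U (x.1 i) + B) * (c i * x.2 i) = x.2 i * A - (c i * x.2 i) * B := by ring
    rw [h1, hA, hB, Finset.mul_sum, Finset.mul_sum, ← Finset.sum_sub_distrib]
    refine Finset.sum_congr rfl fun k _ => ?_
    rw [Finset.mul_sum, Finset.mul_sum, ← Finset.sum_sub_distrib]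
    refine Finset.sum_congr rfl fun l _ => ?_
    split_ifs <;> ring
  simp only [key]
  rw [Finset.sum_comm]
  refine Finset.sum_congr rfl fun k _ => ?_
  rw [Finset.sum_comm]
  refine Finset.sum_congr rfl fun l _ => ?_
  rw [Finset.sum_ite_irrel, Finset.sum_const_zero]
  split_ifs with hlk
  · simp only [mul_sub, Finset.sum_sub_distrib, mul_ite, mul_one, mul_zero,
      Finset.sum_ite_eq, Finset.mem_univ, if_true]
    ring
  · rfl

/-- The weighted energy is even in the momenta. [folklore] -/
theorem weightedEnergy_neg_momentum (x : PhaseSpace N) : X (x.1, -x.2) = X x := by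
  subst hX
  simp

end Weighted

/-- `X_H = {H, ·}`: the Liouville operator is the Poisson bracket with `H` (`∂_{p_i}H = p_i`).
[folklore] -/
theorem liouvilleOp_eq_poisson (N : ℕ) (f : PhaseSpace N → ℝ) (x : PhaseSpace N) :
    liouvilleOp P N f x = poisson (P.hamiltonian N) f x := by
  simp only [liouvilleOp, poisson, P.partialP_hamiltonian]

/-! ### The site energy `h_m` (weights `[· = m]`) -/

section Site

variable (m : Fin N) (X : PhaseSpace N → ℝ)
  (hX : X = fun x => (∑ k : Fin N, (if k = m then (1 : ℝ) else 0) * (x.2 k ^ 2 / 2 + P.U (x.1 k))) +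
    ∑ k : Fin N, ∑ l : Fin N,
      if l.val = k.val + 1 then ((if k = m then (1 : ℝ) else 0) + (if l = m then (1 : ℝ) else 0)) / 2 *
        P.V (x.1 l - x.1 k) else 0)
include hX

/-- `∂_{p_b} h_m = [b = m] p_b`. [folklore] -/
theorem partialP_siteEnergy (b : Fin N) (x : PhaseSpace N) :
    partialP b X x = (if b = m then (1 : ℝ) else 0) * x.2 b :=
  partialP_weightedEnergy P (fun k => if k = m then (1 : ℝ) else 0) X hX b x

/-- `∂_{p_b} h_m = 0` off site `m`, as functions. [folklore] -/
theorem partialP_siteEnergy_of_ne {b : Fin N} (hb : b ≠ m) : partialP b X = fun _ => 0 := by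
  funext x
  rw [partialP_siteEnergy P m X hX, if_neg hb, zero_mul]

/-- **Local energy balance at an interior-or-not site**: for `m = i + 1`,
`X_H h_m = j_i - j_m` — energy flows into site `m` through the bond `(i, m)` and out through
`(m, m+1)` (the latter current being `0` when `m` is the last site). [folklore] -/
theorem liouvilleOp_siteEnergy (hU : Differentiable ℝ P.U) (hV : Differentiable ℝ P.V)
    {i : Fin N} (him : m.val = i.val + 1) (x : PhaseSpace N) :
    liouvilleOp P N X x = P.bondCurrent N i x - P.bondCurrent N m x := by
  rw [liouvilleOp_eq_poisson, poisson_hamiltonian_weightedEnergy P _ X hX hU hV]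
  unfold OscillatorChain.bondCurrent
  -- split the weight difference `[l = m] - [k = m]`
  have hsplit : ∀ k l : Fin N, (if l.val = k.val + 1 then
      ((if l = m then (1 : ℝ) else 0) - (if k = m then (1 : ℝ) else 0)) *
        (-((x.2 k + x.2 l) / 2 * deriv P.V (x.1 l - x.1 k))) else 0) =
      (if l.val = k.val + 1 then (if l = m then (1 : ℝ) else 0) *
        (-((x.2 k + x.2 l) / 2 * deriv P.V (x.1 l - x.1 k))) else 0) -
      (if l.val = k.val + 1 then (if k = m then (1 : ℝ) else 0) *
        (-((x.2 k + x.2 l) / 2 * deriv P.V (x.1 l - x.1 k))) else 0) := by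
    intro k l; split_ifs <;> ring
  simp only [hsplit, Finset.sum_sub_distrib]
  congr 1
  · -- inflow: only the bond `(i, m)` contributes
    rw [Finset.sum_eq_single_of_mem i (Finset.mem_univ _)]
    · refine Finset.sum_congr rfl fun l _ => ?_
      by_cases hl : l.val = i.val + 1
      · have hlm : l = m := Fin.ext (by omega)
        simp [hlm]
      · simp [hl]
    · intro k _ hk
      refine Finset.sum_eq_zero fun l _ => ?_
      by_cases hl : l.val = k.val + 1
      · have hlm : l ≠ m := fun e => hk (Fin.ext (by subst e; omega))
        simp [hlm]
      · simp [hl]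
  · -- outflow: only `k = m` contributes
    rw [Finset.sum_eq_single_of_mem m (Finset.mem_univ _)]
    · refine Finset.sum_congr rfl fun l _ => ?_
      by_cases hl : l.val = m.val + 1
      · simp [hl]
      · simp [hl]
    · intro k _ hk
      refine Finset.sum_eq_zero fun l _ => ?_
      simp [hk]

/-- The site energy is even in the momenta. [folklore] -/
theorem siteEnergy_neg_momentum (x : PhaseSpace N) : X (x.1, -x.2) = X x :=
  weightedEnergy_neg_momentum P _ X hX x

/-- `0 ≤ h_m` for nonnegative potentials. [folklore] -/
theorem siteEnergy_nonneg (hU0 : ∀ q, 0 ≤ P.U q) (hV0 : ∀ r, 0 ≤ P.V r) (x : PhaseSpace N) : 0 ≤ X x := by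
  subst hX
  refine add_nonneg (Finset.sum_nonneg fun k _ => ?_)
    (Finset.sum_nonneg fun k _ => Finset.sum_nonneg fun l _ => ?_)
  · split_ifs
    · have := hU0 (x.1 k); positivity
    · simp
  · split_ifs
    · have := hV0 (x.1 l - x.1 k); positivity
    · have := hV0 (x.1 l - x.1 k); positivity
    · have := hV0 (x.1 l - x.1 k); positivity
    · have := hV0 (x.1 l - x.1 k); positivity
    · exact le_rfl

/-- `h_m ≤ H` for nonnegative potentials (all other site energies are nonnegative). [folklore] -/
theorem siteEnergy_le_hamiltonian (hU0 : ∀ q, 0 ≤ P.U q) (hV0 : ∀ r, 0 ≤ P.V r) (x : PhaseSpace N) :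
    X x ≤ P.hamiltonian N x := by
  subst hX
  unfold OscillatorChain.hamiltonian
  refine add_le_add (Finset.sum_le_sum fun k _ => ?_)
    (Finset.sum_le_sum fun k _ => Finset.sum_le_sum fun l _ => ?_)
  · have h0 : 0 ≤ x.2 k ^ 2 / 2 + P.U (x.1 k) := by have := hU0 (x.1 k); positivity
    split_ifs
    · linarith
    · linarith
  · have h0 := hV0 (x.1 l - x.1 k)
    split_ifs <;> nlinarith

end Site

end Summit.AtomisticToContinuum.FouriersLaw.Theorems.OddSectorIrreversibility.Corrector

end
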